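import Mathlib.RingTheory.RegularLocalRing.Defs
import Mathlib.RingTheory.Smooth.StandardSmoothOfFree
import Mathlib.RingTheory.Smooth.Field
import Mathlib.RingTheory.Smooth.Locus
import Mathlib.RingTheory.Spectrum.Prime.Jacobson
import Mathlib.RingTheory.Jacobson.Ring
import Mathlib.RingTheory.Localization.LocalizationLocalization
import Mathlib.RingTheory.Nakayama
import Mathlib.FieldTheory.IsAlgClosed.Basic
import Literature.AlgebraicGeometry.Motives.VarietiesRegularProofs
import Literature.AlgebraicGeometry.Motives.CyclesDimensionProofs
import HarnessLib

/-!
# GAGA dimension comparison — commutative algebra at a simple point (lemmas)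

First proof file for the named fact
`Literature.AlgebraicGeometry.HodgeTheory.gaga_le_coheight_of_regularLocus_codim`
(`HodgeTheory/GAGADimension.lean`; Serre, *GAGA* §6 Prop. 3 Cor. 2–3, p. 11: «Les anneaux `𝒪_x` et
`ℋ_x` ont même dimension»). The Lean proof of that fact produces, for an irreducible Zariski-closed
`Z₀ ⊆ X` of codimension `c` on a smooth `n`-fold `X`, a closed point of `Z₀` at which `Z₀(ℂ)` is a
complex submanifold of codimension `c` of `X(ℂ)`, cut out by `c` regular functions with
independent differentials — Serre's «point simple» (GAGA §1 n°4; §2 n°6 Cor. 2: at a simple point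
the analytic space is a manifold whose local coordinates form a regular system of parameters). This
file holds the ring-theoretic lemmas; the assembly is `GAGADimensionSimplePoint.lean`.

* `exists_mul_mem_span_of_isRegularLocalRing` — if `A` is Noetherian and `A_𝔭` is regular of
  dimension `c`, there are `g₁, …, g_c ∈ 𝔭` and `h ∉ 𝔭` with `h · 𝔭 ⊆ (g)`.
* `isSmoothAt_bot`, `exists_isMaximal_isRegularLocalRing` — **generic smoothness** of a finitely
  generated domain `B` over a perfect field: the generic point is formally smooth (Mathlib
  `Algebra.FormallySmooth.of_perfectField`), the smooth locus is open (`Algebra.isOpen_smoothLocus`)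
  and so contains a closed point of any non-empty `D(b)` (`B` is Jacobson); a smooth point is
  standard smooth nearby (`Algebra.IsSmoothAt.exists_notMem_isStandardSmooth`), hence `B_𝔫` is
  regular (the tree's `Motives.isRegularLocalRing_of_isStandardSmoothOfRelativeDimension`,
  Görtz–Wedhorn I Lemma 6.26).
* `ringKrullDim_le_of_mem_span_erase` — in a Noetherian local ring whose maximal ideal is spanned
  by a finite family one member of which is redundant modulo `𝔪²`, `dim ≤ card − 1` (Nakayama,
  `Submodule.le_of_le_smul_of_le_jacobson_bot`, and Krull's `dim R ≤ μ(𝔪)`,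
  `ringKrullDim_le_spanFinrank_maximalIdeal`).
* `eq_zero_of_sum_smul_mem_sq` — if `𝔪 A_𝔪` (`dim A_𝔪 = c + d`) is spanned by
  `g₁, …, g_c, s₁, …, s_d ∈ 𝔪`, no non-trivial `K`-combination of the `gⱼ` lies in `𝔪²`.
* `exists_sub_sum_smul_mem_sq` — at a `K`-rational maximal ideal `𝔪` with `A_𝔪` regular of
  dimension `n`, there are `t₁, …, tₙ ∈ 𝔪` with `𝔪 ⊆ K t₁ + ⋯ + K tₙ + 𝔪²`.

## References

* J.-P. Serre, *Géométrie algébrique et géométrie analytique*, Ann. Inst. Fourier **6** (1956),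
  §1 n°4, §2 n°6 Prop. 3 Cor. 2–3 (p. 11). [SerreGAGA1956]
* U. Görtz, T. Wedhorn, *Algebraic Geometry I*, 2nd ed. (2020), Thm. 6.19 (smooth locus open and
  dense), Lemma 6.26 (smooth over a field implies regular). [GortzWedhorn2020]
* H. Matsumura, *Commutative Ring Theory* (1986), Thm. 2.2 (Nakayama), §14 (regular local rings).
-/

noncomputable section

open IsLocalRing

universe u

namespace Literature.AlgebraicGeometry.HodgeTheory

namespace GAGADimension

/-! ### Generators of a prime ideal coming from a regular localisation -/

section Generators

variable {A : Type*} [CommRing A]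

/-- If `A` is Noetherian and `A_𝔭` is a regular local ring of dimension `c`, then there are
`g₁, …, g_c ∈ 𝔭` and `h ∉ 𝔭` with `h · 𝔭 ⊆ (g₁, …, g_c)`: the `c` generators of `𝔭 A_𝔭` may be taken
in `𝔭`, and finitely many denominators are cleared at once. [folklore] -/
theorem exists_mul_mem_span_of_isRegularLocalRing [IsNoetherianRing A] (𝔭 : Ideal A) [𝔭.IsPrime]
    [IsRegularLocalRing (Localization.AtPrime 𝔭)] {c : ℕ}
    (hc : ringKrullDim (Localization.AtPrime 𝔭) = c) :
    ∃ g : Fin c → A, (∀ j, g j ∈ 𝔭) ∧ ∃ h ∉ 𝔭, ∀ a ∈ 𝔭, h * a ∈ Ideal.span (Set.range g) := by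
  classical
  set S := Localization.AtPrime 𝔭
  have hrank : (maximalIdeal S).spanFinrank = c := by
    have h := IsRegularLocalRing.spanFinrank_maximalIdeal (R := S)
    rw [hc] at h
    exact_mod_cast h
  obtain ⟨s, hscard, hsspan⟩ :=
    Submodule.FG.exists_span_finset_card_eq_spanFinrank (IsNoetherian.noetherian (maximalIdeal S))
  rw [hrank] at hscard
  let e : s ≃ Fin c := s.equivFinOfCardEq hscard
  let σ : Fin c → S := fun j => (e.symm j : S)
  have hσmem : ∀ j, σ j ∈ maximalIdeal S := fun j => by
    rw [← hsspan]
    exact Submodule.subset_span (e.symm j).2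
  have hσspan : maximalIdeal S ≤ Ideal.span (Set.range σ) := by
    rw [← hsspan]
    refine Submodule.span_le.2 fun x hx => Ideal.subset_span ⟨e ⟨x, hx⟩, ?_⟩
    simp [σ]
  choose a y hay using fun j => IsLocalization.exists_mk'_eq 𝔭.primeCompl (σ j)
  refine ⟨a, fun j => ?_, ?_⟩
  · have h1 := hσmem j
    rw [← hay j] at h1
    exact (IsLocalization.AtPrime.mk'_mem_maximal_iff S 𝔭 (a j) (y j)).1 h1
  · set I : Ideal A := Ideal.span (Set.range a) with hI
    have hmap : maximalIdeal S ≤ I.map (algebraMap A S) := by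
      refine hσspan.trans (Ideal.span_le.2 ?_)
      rintro _ ⟨j, rfl⟩
      rw [← hay j, IsLocalization.mk'_eq_mul_mk'_one]
      exact Ideal.mul_mem_right _ _ (Ideal.mem_map_of_mem _ (Ideal.subset_span ⟨j, rfl⟩))
    have key : ∀ p ∈ 𝔭, ∃ m ∈ 𝔭.primeCompl, m * p ∈ I := fun p hp => by
      have h1 : algebraMap A S p ∈ I.map (algebraMap A S) :=
        hmap ((IsLocalization.AtPrime.to_map_mem_maximal_iff S 𝔭 p).2 hp)
      exact (IsLocalization.algebraMap_mem_map_algebraMap_iff 𝔭.primeCompl S I p).1 h1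
    choose! m hm hmI using key
    obtain ⟨T, hT⟩ := (IsNoetherian.noetherian 𝔭 : 𝔭.FG)
    have hTmem : ∀ p ∈ T, p ∈ 𝔭 := fun p hp => hT ▸ Submodule.subset_span hp
    refine ⟨∏ p ∈ T, m p, ?_, fun x hx => ?_⟩
    · exact (prod_mem fun p hp => hm p (hTmem p hp) : (∏ p ∈ T, m p) ∈ 𝔭.primeCompl)
    · let J : Ideal A := Submodule.comap (LinearMap.mulLeft A (∏ p ∈ T, m p)) I
      have hJ : 𝔭 ≤ J := by
        rw [← hT]
        refine Submodule.span_le.2 fun p hp => ?_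
        change (∏ p ∈ T, m p) * p ∈ I
        rw [← Finset.prod_erase_mul _ _ hp, mul_assoc]
        exact Ideal.mul_mem_left _ _ (hmI p (hTmem p hp))
      exact hJ hx

end Generators

/-! ### Generic smoothness of affine domains over a perfect field -/

section GenericSmoothness

variable (K : Type*) [Field K]

/-- The generic point of a finitely generated domain `B` over a perfect field is a smooth point:
`Frac B` is formally smooth over `K` (separably generated; Mathlib
`Algebra.FormallySmooth.of_perfectField`). [cite: GortzWedhorn2020, Thm. 6.19] -/
theorem isSmoothAt_bot [PerfectField K] (B : Type*) [CommRing B] [IsDomain B] [Algebra K B]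
    [Algebra.FiniteType K B] : Algebra.IsSmoothAt K (⊥ : Ideal B) := by
  set L := Localization.AtPrime (⊥ : Ideal B)
  haveI : IsFractionRing B L := by
    change IsLocalization (nonZeroDivisors B) L
    rw [← Ideal.primeCompl_bot]
    infer_instance
  letI : Field L := IsFractionRing.toField B
  change Algebra.FormallySmooth K L
  exact Algebra.FormallySmooth.of_perfectField

/-- **Generic smoothness (affine domains over a perfect field).** A finitely generated domain
`B` over a perfect field `K` has, in every non-empty basic open set `D(b)`, a maximal ideal `𝔫`
with `B_𝔫` a regular local ring. [cite: GortzWedhorn2020, Thm. 6.19 and Lemma 6.26] -/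
theorem exists_isMaximal_isRegularLocalRing [PerfectField K] (B : Type*) [CommRing B] [IsDomain B]
    [Algebra K B] [Algebra.FiniteType K B] (b : B) (hb : b ≠ 0) :
    ∃ (𝔫 : Ideal B) (_ : 𝔫.IsMaximal), b ∉ 𝔫 ∧ IsRegularLocalRing (Localization.AtPrime 𝔫) := by
  haveI : IsNoetherianRing B := Algebra.FiniteType.isNoetherianRing K B
  haveI : Algebra.FinitePresentation K B := (Algebra.FinitePresentation.of_finiteType).mp ‹_›
  haveI : IsJacobsonRing B := isJacobsonRing_of_finiteType (A := K)
  set W : Set (PrimeSpectrum B) :=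
    Algebra.smoothLocus K B ∩ (PrimeSpectrum.basicOpen b : Set (PrimeSpectrum B)) with hW
  have hWo : IsOpen W := Algebra.isOpen_smoothLocus.inter (PrimeSpectrum.basicOpen b).2
  have hWne : W.Nonempty := by
    refine ⟨⟨⊥, Ideal.isPrime_bot⟩, ?_, ?_⟩
    · exact isSmoothAt_bot K B
    · simpa using hb
  obtain ⟨x, hxW, hxcl⟩ := nonempty_inter_closedPoints hWne hWo.isLocallyClosed
  have hmax : x.asIdeal.IsMaximal :=
    (PrimeSpectrum.isClosed_singleton_iff_isMaximal x).1 (mem_closedPoints_iff.1 hxcl)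
  refine ⟨x.asIdeal, hmax, ?_, ?_⟩
  · simpa using hxW.2
  · haveI : Algebra.IsSmoothAt K x.asIdeal := hxW.1
    obtain ⟨f, hf, hstd⟩ := Algebra.IsSmoothAt.exists_notMem_isStandardSmooth K x.asIdeal
    obtain ⟨ι, τ, _, _, ⟨P⟩⟩ := hstd.out
    haveI := P.isStandardSmoothOfRelativeDimension rfl
    have hdisj : Disjoint (Submonoid.powers f : Set B) x.asIdeal := by
      rw [Ideal.disjoint_powers_iff_notMem_of_isPrime]
      exact hf
    set 𝔫' : Ideal (Localization.Away f) := x.asIdeal.map (algebraMap B _) with h𝔫'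
    haveI : 𝔫'.IsPrime := IsLocalization.isPrime_of_isPrime_disjoint (.powers f) _ _ x.2 hdisj
    have hreg := Literature.AlgebraicGeometry.Motives.isRegularLocalRing_of_isStandardSmoothOfRelativeDimension
      K P.dimension 𝔫'
    have hunder : 𝔫'.comap (algebraMap B (Localization.Away f)) = x.asIdeal :=
      IsLocalization.under_map_of_isPrime_disjoint (.powers f) _ x.2 hdisj
    let e := IsLocalization.localizationLocalizationAtPrimeIsoLocalization (Submonoid.powers f) 𝔫'
    haveI := hreg
    have hreg' : IsRegularLocalRing
        (Localization.AtPrime (𝔫'.comap (algebraMap B (Localization.Away f)))) :=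
      IsRegularLocalRing.of_ringEquiv e.symm.toRingEquiv
    have transfer : ∀ (J : Ideal B) (hJ : J.IsPrime), J = x.asIdeal →
        IsRegularLocalRing (Localization.AtPrime J) →
        IsRegularLocalRing (Localization.AtPrime x.asIdeal) := by
      rintro J hJ rfl h
      exact h
    exact transfer _ inferInstance hunder hreg'

end GenericSmoothness

/-! ### Nakayama: a redundant generator lowers the dimension -/

section Nakayama

variable {R : Type*} [CommRing R] [IsLocalRing R] [IsNoetherianRing R]

/-- In a Noetherian local ring whose maximal ideal is spanned by a finite family `w` of its
elements, if one member `w i₀` lies in the span of the others plus `𝔪²`, then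
`dim R ≤ card − 1`: by Nakayama the others already span `𝔪`, and `dim R ≤ μ(𝔪)` (Krull).
[folklore] -/
theorem ringKrullDim_le_of_mem_span_erase {ι : Type*} [Fintype ι] (w : ι → R)
    (hwm : ∀ i, w i ∈ maximalIdeal R) (hw : maximalIdeal R ≤ Ideal.span (Set.range w)) (i₀ : ι)
    (hi₀ : w i₀ ∈ Ideal.span (w '' (Set.univ \ {i₀})) ⊔ maximalIdeal R * maximalIdeal R) :
    ringKrullDim R ≤ (Fintype.card ι - 1 : ℕ) := by
  have hle : maximalIdeal R ≤
      Ideal.span (w '' (Set.univ \ {i₀})) ⊔ maximalIdeal R • maximalIdeal R := by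
    refine hw.trans (Ideal.span_le.2 ?_)
    rintro _ ⟨i, rfl⟩
    by_cases hi : i = i₀
    · subst hi
      simpa only [Ideal.smul_eq_mul, SetLike.mem_coe] using hi₀
    · exact Ideal.mem_sup_left (Ideal.subset_span ⟨i, ⟨Set.mem_univ _, hi⟩, rfl⟩)
  have hN'le : Ideal.span (w '' (Set.univ \ {i₀})) ≤ maximalIdeal R := by
    refine Ideal.span_le.2 ?_
    rintro _ ⟨i, -, rfl⟩
    exact hwm i
  have hmN' : maximalIdeal R ≤ Ideal.span (w '' (Set.univ \ {i₀})) :=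
    Submodule.le_of_le_smul_of_le_jacobson_bot (IsNoetherian.noetherian _)
      (maximalIdeal_le_jacobson ⊥) hle
  have heq : maximalIdeal R = Ideal.span (w '' (Set.univ \ {i₀})) := le_antisymm hmN' hN'le
  have hcard : (maximalIdeal R).spanFinrank ≤ Fintype.card ι - 1 := by
    rw [heq]
    refine (Submodule.spanFinrank_span_le_ncard_of_finite ((Set.toFinite _).image w)).trans ?_
    refine (Set.ncard_image_le (Set.toFinite _)).trans ?_
    rw [Set.ncard_sdiff_singleton_of_mem (Set.mem_univ _), Set.ncard_univ, Nat.card_eq_fintype_card]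
  calc ringKrullDim R ≤ (maximalIdeal R).spanFinrank := ringKrullDim_le_spanFinrank_maximalIdeal R
    _ ≤ ((Fintype.card ι - 1 : ℕ) : WithBot ℕ∞) := by exact_mod_cast hcard

end Nakayama

/-! ### Independence modulo `𝔪²` of part of a system of generators of `𝔪 A_𝔪` -/

section Independence

variable (K : Type*) [Field K] {A : Type*} [CommRing A] [IsNoetherianRing A] [Algebra K A]

/-- Let `𝔪 ⊂ A` be maximal with `dim A_𝔪 = c + d`, and suppose `𝔪 A_𝔪` is spanned by the images
of `g₁, …, g_c, s₁, …, s_d ∈ 𝔪`. Then the `gⱼ` are linearly independent modulo `𝔪²` over `K`: a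
relation `∑ λⱼ gⱼ ∈ 𝔪²` with `λ_{j₀} ≠ 0` would make `g_{j₀}` redundant and force `dim A_𝔪 < c + d`
(`ringKrullDim_le_of_mem_span_erase`). [folklore] -/
theorem eq_zero_of_sum_smul_mem_sq (𝔪 : Ideal A) [𝔪.IsMaximal] {c d : ℕ}
    (hdim : ringKrullDim (Localization.AtPrime 𝔪) = (c + d : ℕ)) (g : Fin c → A) (s : Fin d → A)
    (hg : ∀ j, g j ∈ 𝔪) (hs : ∀ i, s i ∈ 𝔪)
    (hspan : maximalIdeal (Localization.AtPrime 𝔪) ≤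
      Ideal.span (Set.range (algebraMap A (Localization.AtPrime 𝔪) ∘ g) ∪
        Set.range (algebraMap A (Localization.AtPrime 𝔪) ∘ s)))
    (coef : Fin c → K) (hmem : ∑ j, coef j • g j ∈ 𝔪 ^ 2) : coef = 0 := by
  classical
  by_contra hne
  obtain ⟨j₀, hj₀⟩ : ∃ j₀, coef j₀ ≠ 0 := by
    by_contra h
    push Not at h
    exact hne (funext h)
  let S := Localization.AtPrime 𝔪
  let w : Fin c ⊕ Fin d → S := Sum.elim (algebraMap A S ∘ g) (algebraMap A S ∘ s)
  have hwm : ∀ i, w i ∈ maximalIdeal S := by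
    rintro (j | i)
    · exact (IsLocalization.AtPrime.to_map_mem_maximal_iff S 𝔪 _).2 (hg j)
    · exact (IsLocalization.AtPrime.to_map_mem_maximal_iff S 𝔪 _).2 (hs i)
  have hw : maximalIdeal S ≤ Ideal.span (Set.range w) := by
    refine hspan.trans (Ideal.span_mono ?_)
    rintro x (⟨j, rfl⟩ | ⟨i, rfl⟩)
    · exact ⟨Sum.inl j, rfl⟩
    · exact ⟨Sum.inr i, rfl⟩
  have hgj₀ : g j₀ = algebraMap K A (coef j₀)⁻¹ *
      ((∑ j, coef j • g j) - ∑ j ∈ Finset.univ.erase j₀, coef j • g j) := by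
    rw [← Finset.add_sum_erase Finset.univ (fun j => coef j • g j) (Finset.mem_univ j₀),
      add_sub_cancel_right, Algebra.smul_def, ← mul_assoc, ← map_mul, inv_mul_cancel₀ hj₀,
      map_one, one_mul]
  have hi₀ : w (Sum.inl j₀) ∈ Ideal.span (w '' (Set.univ \ {Sum.inl j₀})) ⊔
      maximalIdeal S * maximalIdeal S := by
    change algebraMap A S (g j₀) ∈ _
    rw [hgj₀, map_mul, map_sub]
    refine Ideal.mul_mem_left _ _ (Ideal.sub_mem _ ?_ ?_)
    · refine Ideal.mem_sup_right ?_
      have h2 : algebraMap A S (∑ j, coef j • g j) ∈ (𝔪 ^ 2).map (algebraMap A S) :=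
        Ideal.mem_map_of_mem _ hmem
      rwa [Ideal.map_pow, Localization.AtPrime.map_eq_maximalIdeal, pow_two] at h2
    · refine Ideal.mem_sup_left ?_
      rw [map_sum]
      refine Ideal.sum_mem _ fun j hj => ?_
      rw [Algebra.smul_def, map_mul]
      refine Ideal.mul_mem_left _ _ (Ideal.subset_span ⟨Sum.inl j, ⟨Set.mem_univ _, ?_⟩, rfl⟩)
      have hjne : j ≠ j₀ := (Finset.mem_erase.1 hj).1
      simpa using hjne
  have hle := ringKrullDim_le_of_mem_span_erase w hwm hw (Sum.inl j₀) hi₀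
  rw [hdim, Fintype.card_sum, Fintype.card_fin, Fintype.card_fin] at hle
  have h1 : (c + d : ℕ) ≤ c + d - 1 := by exact_mod_cast hle
  have h2 := j₀.isLt
  omega

/-- **Local coordinates modulo `𝔪²`.** If `𝔪` is a `K`-rational maximal ideal (`A → K` with
kernel `𝔪`) and `A_𝔪` is regular of dimension `n`, then there are `t₁, …, tₙ ∈ 𝔪` such that every
element of `𝔪` is a `K`-linear combination of the `tᵢ` modulo `𝔪²` (the `tᵢ` generate `𝔪 A_𝔪`, and
coefficients are reduced to constants modulo `𝔪`). [folklore] -/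
theorem exists_sub_sum_smul_mem_sq (𝔪 : Ideal A) [𝔪.IsMaximal]
    [IsRegularLocalRing (Localization.AtPrime 𝔪)] {n : ℕ}
    (hdim : ringKrullDim (Localization.AtPrime 𝔪) = n) (ψ : A →ₐ[K] K)
    (hψ : ∀ a, ψ a = 0 ↔ a ∈ 𝔪) :
    ∃ t : Fin n → A, (∀ i, t i ∈ 𝔪) ∧
      ∀ a ∈ 𝔪, ∃ coef : Fin n → K, a - ∑ i, coef i • t i ∈ 𝔪 ^ 2 := by
  classical
  obtain ⟨t, ht, u, hu, hut⟩ := exists_mul_mem_span_of_isRegularLocalRing 𝔪 hdim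
  refine ⟨t, ht, fun a ha => ?_⟩
  obtain ⟨r, hr⟩ := (Submodule.mem_span_range_iff_exists_fun A).1 (hut a ha)
  have hr' : ∑ i, r i * t i = u * a := by simpa only [smul_eq_mul] using hr
  have hsub : ∀ x : A, x - algebraMap K A (ψ x) ∈ 𝔪 := fun x => (hψ _).1 (by simp)
  have hu0 : ψ u ≠ 0 := fun h => hu ((hψ u).1 h)
  have key : algebraMap K A (ψ u) * a - ∑ i, ψ (r i) • t i ∈ 𝔪 ^ 2 := by
    have e1 : algebraMap K A (ψ u) * a - ∑ i, ψ (r i) • t i =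
        (algebraMap K A (ψ u) - u) * a + ∑ i, (r i - algebraMap K A (ψ (r i))) * t i := by
      simp only [Algebra.smul_def, sub_mul, Finset.sum_sub_distrib, hr']
      ring
    rw [e1, pow_two]
    refine Ideal.add_mem _ (Ideal.mul_mem_mul ?_ ha) (Ideal.sum_mem _ fun i _ =>
      Ideal.mul_mem_mul (hsub (r i)) (ht i))
    have := hsub u
    rw [← neg_sub] at this
    exact (Ideal.neg_mem_iff _).1 this
  refine ⟨fun i => (ψ u)⁻¹ * ψ (r i), ?_⟩
  have e2 : (fun i => ((ψ u)⁻¹ * ψ (r i)) • t i) =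
      fun i => algebraMap K A (ψ u)⁻¹ * (ψ (r i) • t i) := by
    funext i
    rw [mul_smul, Algebra.smul_def]
  have e3 : a = algebraMap K A (ψ u)⁻¹ * (algebraMap K A (ψ u) * a) := by
    rw [← mul_assoc, ← map_mul, inv_mul_cancel₀ hu0, map_one, one_mul]
  rw [e2, ← Finset.mul_sum, e3, ← mul_sub]
  exact Ideal.mul_mem_left _ _ key

end Independence

end GAGADimension

end Literature.AlgebraicGeometry.HodgeTheory
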